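import Summits.QuantumFields.BalabanUV.Beta.VertexToriSymmetryJet

/-!
# Beta / VertexToriSymmetryCovariantQ — covariance with MOMENTUM-DEPENDENT conjugators `A(τ q) = U(q)·A(q)·V(q)` (the form the
# cell's reflections actually take: cap5-g4 O-sym-2 ∕ cap3-g14 §4.23 (d)), the scalar transports it yields, and what it does NOT yield
# (β sub-cell, BINDER-OWNERS row CAP-k, lineage `b2b-balaban-beta-an5`, gen 22; node BETA-an5-g22-TORI-SYMMETRY part 5)

`Beta/VertexToriSymmetryCovariant` treats CONSTANT conjugators.  The exact table check of the cell (cap5-g4, journal l.12766: the 36 rational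
tables of engine E are entrywise covariant under the axis reflections `R₂, R₃`; cap3-g14 CAP-KERNEL v0.7.12 §4.23 (d): `Stab(G_L) = {1, R₂, R₃,
R₂R₃}`, «a non-jet reflection is a signed permutation Π of the 744 indices with k(Rq) = Π k(q) Πᵀ») comes with the rider (cap5) that on the
shifted bond ∕ constraint indices the conjugator is MONOMIAL WITH q-DEPENDENT PHASES, `U(q)_{Πi,i} = s_i·χ_q(c_i)⁻¹` — i.e. the covariance is
`A(R_ν q) = U(q)·A(q)·U(q)⁻¹` with `U(q) = D(q)·Π`, `D(q)` a diagonal of lattice characters.  This module is that case: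

* §1 `MatCovariantQ τ U V A := ∀ q, A (τ q) = U q * A q * V q` with `V q * U q = 1`: the whole one-loop algebra of part 3 goes through
  POINTWISE in `q` (`const ∕ add ∕ neg ∕ sub ∕ smul ∕ sum ∕ mul ∕ inv`, `trace_eq`, `det_eq`, `trace_resolvent_covariantQ`, `trace_bubble_covariantQ`,
  `oneLoopForm_covariantQ`); a constant-conjugator family is a special case (`MatCovariant.toQ`).
* §2 THE SHIFTED FAMILY needs MORE than in part 3: `A(τ q − p) = U(q − p)·A(q − p)·V(q − p)` carries the conjugator AT `q − p`; it is covariant with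
  the SAME conjugator as the unshifted families iff `U (q − p) = U q` (`MatCovariantQ.comp_sub`) — for phase conjugators `D(q) = diag χ_q(c_i)`
  this is `χ_p(c_i) = 1`, i.e. the index shifts `c_i` are ORTHOGONAL to the source momentum (`character_sub_of_orthogonal`,
  `phaseDiag_sub_of_orthogonal`): automatically so when the `c_i` point along the reflected (non-jet) direction and `p` along the jet
  directions — the structural reason cap3's float check finds the JET functional `R₂, R₃`-invariant.  Three-slot form: `MatCovariantQ₃`,
  `MatCovariantQ.shift₃`, `oneLoopForm₃_invariantQ`, and the END `oneLoopJet_norm_le_vertexTori_of_plusRegionQ` (a face bound of the jet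
  functional on the tori with `Im q_ν = +w_ν` for the covariantly reflected non-jet directions is a bound on all tori).
* WHAT IT DOES NOT YIELD (on purpose): at complex `q` the phases `χ_q(c_i)` are not unimodular, `U(q)` is not unitary, and the Euclidean operator
  norm of the resolvent is NOT transported — `‖k₀(R_ν q)⁻¹‖₂ ≠ ‖k₀(q)⁻¹‖₂` in general (consistent with cap3 J24d ∕ J25c: the sup of `‖X‖₂` sits
  on particular sign classes).  For route A's `hBa` only the ISOMETRIC symmetries transport: `conjNeg` (`MatConjSymm`, part 2) and negation
  (`MatNegTranspose`, part 2) — a face certificate of `‖k₀⁻¹‖₂` must cover the `(s₂, s₃)` sign classes separately.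

HONEST FRAMING.  Kernel glue ([folklore]): the covariance of the cell's actual tables is NOT asserted (hypotheses; cap5's check is an exact finite
identity OUTSIDE the kernel); no number of the β-function, no certificate, no binder INSTANCE.  Discharging `BetaPertH` would make Bałaban's
ultraviolet stability unconditional — NOT the continuum limit, NOT the Clay problem.  0 `sorry`, 0 cite tags.
-/

namespace Summit.QuantumFields.BalabanUV.Beta.VertexToriSymmetry

open Complex Set Matrix
open Literature.MathematicalPhysics.QuantumFieldTheory.Balaban1983to89
open Summit.QuantumFields.BalabanUV.Beta.TubeMaximumModulus
open Summit.QuantumFields.BalabanUV.Beta.PolyRegularAlgebra (character)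
open Summit.QuantumFields.BalabanUV.Beta.JetCoefficientCauchy (jetFunctional)
open scoped Real ComplexConjugate Matrix.Norms.L2Operator

noncomputable section

variable {d : ℕ} {n : Type*} [Fintype n] [DecidableEq n]

/-! ## §1 Momentum-dependent conjugators: the one-loop algebra, pointwise in `q` -/

section CovariantQ

/-- COVARIANCE with MOMENTUM-DEPENDENT conjugators: `A (τ q) = U q * A q * V q`. [folklore] -/
def MatCovariantQ (τ : (Fin (d + 1) → ℂ) → (Fin (d + 1) → ℂ)) (U V : (Fin (d + 1) → ℂ) → Matrix n n ℂ)
    (A : (Fin (d + 1) → ℂ) → Matrix n n ℂ) : Prop :=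
  ∀ q, A (τ q) = U q * A q * V q

variable {τ : (Fin (d + 1) → ℂ) → (Fin (d + 1) → ℂ)} {U V : (Fin (d + 1) → ℂ) → Matrix n n ℂ}
  {A B C D : (Fin (d + 1) → ℂ) → Matrix n n ℂ}

omit [DecidableEq n] in
/-- constant conjugators are a special case. [folklore] -/
theorem MatCovariant.toQ {U₀ V₀ : Matrix n n ℂ} (h : MatCovariant τ U₀ V₀ A) : MatCovariantQ τ (fun _ => U₀) (fun _ => V₀) A := h

omit [DecidableEq n] in
/-- a constant family commuting with every conjugator pair. [folklore] -/
theorem matCovariantQ_const {K : Matrix n n ℂ} (hK : ∀ q, U q * K * V q = K) : MatCovariantQ τ U V (fun _ => K) :=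
  fun q => (hK q).symm

omit [DecidableEq n] in
/-- sums. [folklore] -/
theorem matCovariantQ_add (hA : MatCovariantQ τ U V A) (hB : MatCovariantQ τ U V B) :
    MatCovariantQ τ U V (fun q => A q + B q) :=
  fun q => by show A (τ q) + B (τ q) = U q * (A q + B q) * V q; rw [hA q, hB q, Matrix.mul_add, Matrix.add_mul]

omit [DecidableEq n] in
/-- negation. [folklore] -/
theorem matCovariantQ_neg (hA : MatCovariantQ τ U V A) : MatCovariantQ τ U V (fun q => -A q) :=
  fun q => by show -A (τ q) = U q * (-A q) * V q; rw [hA q, Matrix.mul_neg, Matrix.neg_mul]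

omit [DecidableEq n] in
/-- differences. [folklore] -/
theorem matCovariantQ_sub (hA : MatCovariantQ τ U V A) (hB : MatCovariantQ τ U V B) :
    MatCovariantQ τ U V (fun q => A q - B q) :=
  fun q => by show A (τ q) - B (τ q) = U q * (A q - B q) * V q; rw [hA q, hB q, Matrix.mul_sub, Matrix.sub_mul]

omit [DecidableEq n] in
/-- scalar multiples by a `τ`-invariant scalar family. [folklore] -/
theorem matCovariantQ_smul (hA : MatCovariantQ τ U V A) {g : (Fin (d + 1) → ℂ) → ℂ} (hg : ∀ q, g (τ q) = g q) :
    MatCovariantQ τ U V (fun q => g q • A q) :=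
  fun q => by show g (τ q) • A (τ q) = U q * (g q • A q) * V q; rw [hA q, hg q, Matrix.mul_smul, Matrix.smul_mul]

omit [DecidableEq n] in
/-- finite sums. [folklore] -/
theorem matCovariantQ_sum {ι : Type*} (s : Finset ι) {F : ι → (Fin (d + 1) → ℂ) → Matrix n n ℂ}
    (h : ∀ i ∈ s, MatCovariantQ τ U V (F i)) : MatCovariantQ τ U V (fun q => ∑ i ∈ s, F i q) := by
  classical
  induction s using Finset.induction_on with
  | empty => intro q; simp
  | @insert i s hi ih =>
    have h' := matCovariantQ_add (h i (Finset.mem_insert_self i s)) (ih fun j hj => h j (Finset.mem_insert_of_mem hj))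
    intro q
    simpa only [Finset.sum_insert hi] using h' q

/-- products (`V q * U q = 1`). [folklore] -/
theorem matCovariantQ_mul (hVU : ∀ q, V q * U q = 1) (hA : MatCovariantQ τ U V A) (hB : MatCovariantQ τ U V B) :
    MatCovariantQ τ U V (fun q => A q * B q) := fun q => by
  show A (τ q) * B (τ q) = U q * (A q * B q) * V q
  rw [hA q, hB q]
  calc U q * A q * V q * (U q * B q * V q) = U q * A q * (V q * U q) * B q * V q := by simp only [Matrix.mul_assoc]
    _ = U q * (A q * B q) * V q := by rw [hVU q, Matrix.mul_one, Matrix.mul_assoc (U q)]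

/-- the inverse family. [folklore] -/
theorem matCovariantQ_inv (hVU : ∀ q, V q * U q = 1) (hA : MatCovariantQ τ U V A) :
    MatCovariantQ τ U V (fun q => (A q)⁻¹) := fun q => by
  show (A (τ q))⁻¹ = U q * (A q)⁻¹ * V q
  rw [hA q, Matrix.mul_inv_rev, Matrix.mul_inv_rev, Matrix.inv_eq_right_inv (hVU q), Matrix.inv_eq_left_inv (hVU q),
    Matrix.mul_assoc]

/-- the trace is `τ`-invariant. [folklore] -/
theorem matCovariantQ_trace_eq (hVU : ∀ q, V q * U q = 1) (hA : MatCovariantQ τ U V A) (q : Fin (d + 1) → ℂ) :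
    (A (τ q)).trace = (A q).trace := by
  rw [hA q, Matrix.trace_mul_cycle, hVU q, Matrix.one_mul]

/-- the determinant is `τ`-invariant. [folklore] -/
theorem matCovariantQ_det_eq (hVU : ∀ q, V q * U q = 1) (hA : MatCovariantQ τ U V A) (q : Fin (d + 1) → ℂ) :
    (A (τ q)).det = (A q).det := by
  rw [hA q, Matrix.det_mul, Matrix.det_mul]
  have h := congrArg Matrix.det (hVU q)
  rw [Matrix.det_mul, Matrix.det_one] at h
  calc (U q).det * (A q).det * (V q).det = ((V q).det * (U q).det) * (A q).det := by ring
    _ = (A q).det := by rw [h, one_mul]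

/-- tadpole trace invariant. [folklore] -/
theorem trace_resolvent_covariantQ (hVU : ∀ q, V q * U q = 1) (hA : MatCovariantQ τ U V A) (hB : MatCovariantQ τ U V B)
    (q : Fin (d + 1) → ℂ) : ((A (τ q))⁻¹ * B (τ q)).trace = ((A q)⁻¹ * B q).trace :=
  matCovariantQ_trace_eq hVU (matCovariantQ_mul hVU (matCovariantQ_inv hVU hA) hB) q

/-- bubble trace invariant. [folklore] -/
theorem trace_bubble_covariantQ {A' : (Fin (d + 1) → ℂ) → Matrix n n ℂ} (hVU : ∀ q, V q * U q = 1) (hA : MatCovariantQ τ U V A)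
    (hC : MatCovariantQ τ U V C) (hA' : MatCovariantQ τ U V A') (hD : MatCovariantQ τ U V D) (q : Fin (d + 1) → ℂ) :
    ((A (τ q))⁻¹ * C (τ q) * (A' (τ q))⁻¹ * D (τ q)).trace = ((A q)⁻¹ * C q * (A' q)⁻¹ * D q).trace :=
  matCovariantQ_trace_eq hVU
    (matCovariantQ_mul hVU (matCovariantQ_mul hVU (matCovariantQ_mul hVU (matCovariantQ_inv hVU hA) hC)
      (matCovariantQ_inv hVU hA')) hD) q

/-- **the scalar one-loop form `t₁ − t₂` is `τ`-invariant for momentum-dependent conjugators** (the transport hypothesis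
`G (reflectAt ν q) = G q` of `VertexToriSymmetryEnds` for this form). [folklore] -/
theorem oneLoopForm_covariantQ {A' : (Fin (d + 1) → ℂ) → Matrix n n ℂ} (hVU : ∀ q, V q * U q = 1) (hA : MatCovariantQ τ U V A)
    (hA' : MatCovariantQ τ U V A') (hB : MatCovariantQ τ U V B) (hC : MatCovariantQ τ U V C) (hD : MatCovariantQ τ U V D)
    (q : Fin (d + 1) → ℂ) :
    ((A (τ q))⁻¹ * B (τ q)).trace - ((A (τ q))⁻¹ * C (τ q) * (A' (τ q))⁻¹ * D (τ q)).trace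
      = ((A q)⁻¹ * B q).trace - ((A q)⁻¹ * C q * (A' q)⁻¹ * D q).trace := by
  rw [trace_resolvent_covariantQ hVU hA hB, trace_bubble_covariantQ hVU hA hC hA' hD]

end CovariantQ

/-! ## §2 The shifted family, phase conjugators orthogonal to the source momentum, the jet END -/

section Shift

variable {τ : (Fin (d + 1) → ℂ) → (Fin (d + 1) → ℂ)} {U V : (Fin (d + 1) → ℂ) → Matrix n n ℂ}
  {A : (Fin (d + 1) → ℂ) → Matrix n n ℂ}

omit [DecidableEq n] in
/-- **THE SHIFTED FAMILY** `q ↦ A (q − p)` is covariant with the SAME conjugators iff these do not see the shift: hypotheses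
`τ (q − p) = τ q − p`, `U (q − p) = U q`, `V (q − p) = V q`. [folklore] -/
theorem matCovariantQ_comp_sub (hA : MatCovariantQ τ U V A) {p : Fin (d + 1) → ℂ} (hτ : ∀ q, τ (q - p) = τ q - p)
    (hU : ∀ q, U (q - p) = U q) (hV : ∀ q, V (q - p) = V q) : MatCovariantQ τ U V (fun q => A (q - p)) := fun q => by
  show A (τ q - p) = U q * A (q - p) * V q
  rw [← hτ q, hA (q - p), hU q, hV q]

omit [Fintype n] [DecidableEq n] in
/-- a lattice character does not see a shift ORTHOGONAL to its frequency: `(∀ μ, x_μ · p_μ = 0) ⟹ χ_{q−p}(x) = χ_q(x)`. [folklore] -/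
theorem character_sub_of_orthogonal (x : Fin (d + 1) → ℤ) {p : Fin (d + 1) → ℂ} (hp : ∀ μ, (x μ : ℂ) * p μ = 0)
    (q : Fin (d + 1) → ℂ) : character x (q - p) = character x q := by
  unfold character
  congr 2
  refine Finset.sum_congr rfl fun μ _ => ?_
  rw [Pi.sub_apply, mul_sub, hp μ, sub_zero]

/-- the PHASE CONJUGATOR `D(q) = diag_i χ_q(c_i)` of a family of index shifts `c`. [folklore] -/
def phaseDiag (c : n → Fin (d + 1) → ℤ) (q : Fin (d + 1) → ℂ) : Matrix n n ℂ := Matrix.diagonal fun i => character (c i) q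

omit [Fintype n] in
/-- a phase conjugator whose shifts are orthogonal to `p` does not see the shift by `p`. [folklore] -/
theorem phaseDiag_sub_of_orthogonal (c : n → Fin (d + 1) → ℤ) {p : Fin (d + 1) → ℂ} (hp : ∀ i μ, (c i μ : ℂ) * p μ = 0)
    (q : Fin (d + 1) → ℂ) : phaseDiag c (q - p) = phaseDiag c q := by
  unfold phaseDiag
  congr 1
  funext i
  exact character_sub_of_orthogonal (c i) (hp i) q

/-- hence a MONOMIAL-PHASE conjugator `U(q) = D(q)·P` (`P` constant) does not see shifts orthogonal to its phases. [folklore] -/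
theorem phaseDiag_mul_sub_of_orthogonal (c : n → Fin (d + 1) → ℤ) (P : Matrix n n ℂ) {p : Fin (d + 1) → ℂ}
    (hp : ∀ i μ, (c i μ : ℂ) * p μ = 0) (q : Fin (d + 1) → ℂ) : phaseDiag c (q - p) * P = phaseDiag c q * P := by
  rw [phaseDiag_sub_of_orthogonal c hp q]

/-- … and neither do right conjugators of the type `P * phaseDiag c q`. [folklore] -/
theorem mul_phaseDiag_sub_of_orthogonal (c : n → Fin (d + 1) → ℤ) (P : Matrix n n ℂ) {p : Fin (d + 1) → ℂ}
    (hp : ∀ i μ, (c i μ : ℂ) * p μ = 0) (q : Fin (d + 1) → ℂ) : P * phaseDiag c (q - p) = P * phaseDiag c q := by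
  rw [phaseDiag_sub_of_orthogonal c hp q]

/-- three-slot covariance in the `q`-slot with momentum-dependent conjugators. [folklore] -/
def MatCovariantQ₃ (τ : (Fin (d + 1) → ℂ) → (Fin (d + 1) → ℂ)) (U V : (Fin (d + 1) → ℂ) → Matrix n n ℂ)
    (A : (Fin (d + 1) → ℂ) → ℂ → ℂ → Matrix n n ℂ) : Prop :=
  ∀ q p₁ p₂, A (τ q) p₁ p₂ = U q * A q p₁ p₂ * V q

omit [DecidableEq n] in
/-- three-slot covariance is covariance at each `(p₁, p₂)`. [folklore] -/
theorem matCovariantQ₃_iff {A : (Fin (d + 1) → ℂ) → ℂ → ℂ → Matrix n n ℂ} :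
    MatCovariantQ₃ τ U V A ↔ ∀ p₁ p₂, MatCovariantQ τ U V (fun q => A q p₁ p₂) :=
  ⟨fun h p₁ p₂ q => h q p₁ p₂, fun h q p₁ p₂ => h p₁ p₂ q⟩

omit [DecidableEq n] in
/-- `q`-only families. [folklore] -/
theorem matCovariantQ_to₃ (h : MatCovariantQ τ U V A) : MatCovariantQ₃ τ U V (fun q _ _ => A q) := fun q _ _ => h q

omit [DecidableEq n] in
/-- **THE SHIFTED THREE-SLOT FAMILY** `(q; p₁, p₂) ↦ A(q − p₁v₁ − p₂v₂)` is covariant with the same conjugators when `τ`, `U`, `V` do not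
see the shift (`reflectAt_shift` ∕ `permute_shift` for `τ`; `phaseDiag_…_of_orthogonal` for phase conjugators). [folklore] -/
theorem matCovariantQ_shift₃ (h : MatCovariantQ τ U V A) (v₁ v₂ : Fin (d + 1) → ℝ)
    (hτ : ∀ (q : Fin (d + 1) → ℂ) (p₁ p₂ : ℂ),
      τ (fun i => q i - (v₁ i : ℂ) * p₁ - (v₂ i : ℂ) * p₂) = fun i => τ q i - (v₁ i : ℂ) * p₁ - (v₂ i : ℂ) * p₂)
    (hU : ∀ (q : Fin (d + 1) → ℂ) (p₁ p₂ : ℂ), U (fun i => q i - (v₁ i : ℂ) * p₁ - (v₂ i : ℂ) * p₂) = U q)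
    (hV : ∀ (q : Fin (d + 1) → ℂ) (p₁ p₂ : ℂ), V (fun i => q i - (v₁ i : ℂ) * p₁ - (v₂ i : ℂ) * p₂) = V q) :
    MatCovariantQ₃ τ U V (fun q p₁ p₂ => A (fun i => q i - (v₁ i : ℂ) * p₁ - (v₂ i : ℂ) * p₂)) := fun q p₁ p₂ => by
  show A (fun i => τ q i - (v₁ i : ℂ) * p₁ - (v₂ i : ℂ) * p₂) = _
  rw [← hτ q p₁ p₂, h, hU, hV]

omit [Fintype n] [DecidableEq n] in
/-- the shift `q ↦ q − p₁v₁ − p₂v₂` in `Pi` form. [folklore] -/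
theorem shift_eq_sub (v₁ v₂ : Fin (d + 1) → ℝ) (q : Fin (d + 1) → ℂ) (p₁ p₂ : ℂ) :
    (fun i => q i - (v₁ i : ℂ) * p₁ - (v₂ i : ℂ) * p₂) = q - fun i => (v₁ i : ℂ) * p₁ + (v₂ i : ℂ) * p₂ := by
  funext i; simp only [Pi.sub_apply]; ring

omit [Fintype n] in
/-- a phase conjugator with shifts orthogonal to both jet directions does not see the jet shift. [folklore] -/
theorem phaseDiag_shift (c : n → Fin (d + 1) → ℤ) {v₁ v₂ : Fin (d + 1) → ℝ} (h₁ : ∀ i μ, (c i μ : ℂ) * v₁ μ = 0)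
    (h₂ : ∀ i μ, (c i μ : ℂ) * v₂ μ = 0) (q : Fin (d + 1) → ℂ) (p₁ p₂ : ℂ) :
    phaseDiag c (fun i => q i - (v₁ i : ℂ) * p₁ - (v₂ i : ℂ) * p₂) = phaseDiag c q := by
  rw [shift_eq_sub]
  refine phaseDiag_sub_of_orthogonal c (fun i μ => ?_) q
  show (c i μ : ℂ) * ((v₁ μ : ℂ) * p₁ + (v₂ μ : ℂ) * p₂) = 0
  rw [mul_add, ← mul_assoc, ← mul_assoc, h₁ i μ, h₂ i μ, zero_mul, zero_mul, add_zero]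

variable {A' B C D : (Fin (d + 1) → ℂ) → ℂ → ℂ → Matrix n n ℂ} {A₃ : (Fin (d + 1) → ℂ) → ℂ → ℂ → Matrix n n ℂ}

/-- the three-slot one-loop form is `τ`-invariant in the `q`-slot (momentum-dependent conjugators, `V q * U q = 1`). [folklore] -/
theorem oneLoopForm₃_invariantQ (hVU : ∀ q, V q * U q = 1) (hA : MatCovariantQ₃ τ U V A₃) (hA' : MatCovariantQ₃ τ U V A')
    (hB : MatCovariantQ₃ τ U V B) (hC : MatCovariantQ₃ τ U V C) (hD : MatCovariantQ₃ τ U V D) (q : Fin (d + 1) → ℂ) (p₁ p₂ : ℂ) :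
    ((A₃ (τ q) p₁ p₂)⁻¹ * B (τ q) p₁ p₂).trace - ((A₃ (τ q) p₁ p₂)⁻¹ * C (τ q) p₁ p₂ * (A' (τ q) p₁ p₂)⁻¹ * D (τ q) p₁ p₂).trace
      = ((A₃ q p₁ p₂)⁻¹ * B q p₁ p₂).trace - ((A₃ q p₁ p₂)⁻¹ * C q p₁ p₂ * (A' q p₁ p₂)⁻¹ * D q p₁ p₂).trace :=
  oneLoopForm_covariantQ (A := fun q => A₃ q p₁ p₂) (A' := fun q => A' q p₁ p₂) (B := fun q => B q p₁ p₂)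
    (C := fun q => C q p₁ p₂) (D := fun q => D q p₁ p₂) hVU
    (matCovariantQ₃_iff.mp hA p₁ p₂) (matCovariantQ₃_iff.mp hA' p₁ p₂) (matCovariantQ₃_iff.mp hB p₁ p₂)
    (matCovariantQ₃_iff.mp hC p₁ p₂) (matCovariantQ₃_iff.mp hD p₁ p₂) q

variable {w : Fin (d + 1) → ℝ}

/-- **END FOR THE ENGINES' INTEGRAND, momentum-dependent conjugators**: with the five three-slot families covariant under the reflections of
the directions `Vs` (per-direction conjugator families with `V q * U q = 1`), a face bound of the JET FUNCTIONAL of the one-loop form on the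
vertex tori with `Im q_ν = +w_ν ∀ ν ∈ Vs` is a bound on all vertex tori. [folklore] -/
theorem oneLoopJet_norm_le_vertexTori_of_plusRegionQ (Vs : Finset (Fin (d + 1)))
    (Uc Vc : Fin (d + 1) → (Fin (d + 1) → ℂ) → Matrix n n ℂ) (hVU : ∀ ν ∈ Vs, ∀ q, Vc ν q * Uc ν q = 1)
    (hA : ∀ ν ∈ Vs, MatCovariantQ₃ (reflectAt ν) (Uc ν) (Vc ν) A₃) (hA' : ∀ ν ∈ Vs, MatCovariantQ₃ (reflectAt ν) (Uc ν) (Vc ν) A')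
    (hB : ∀ ν ∈ Vs, MatCovariantQ₃ (reflectAt ν) (Uc ν) (Vc ν) B) (hC : ∀ ν ∈ Vs, MatCovariantQ₃ (reflectAt ν) (Uc ν) (Vc ν) C)
    (hD : ∀ ν ∈ Vs, MatCovariantQ₃ (reflectAt ν) (Uc ν) (Vc ν) D) {M : ℝ}
    (hM : ∀ q ∈ VertexTori w, (∀ ν ∈ Vs, (q ν).im = w ν) →
      ‖jetFunctional (fun q p₁ p₂ => ((A₃ q p₁ p₂)⁻¹ * B q p₁ p₂).trace
        - ((A₃ q p₁ p₂)⁻¹ * C q p₁ p₂ * (A' q p₁ p₂)⁻¹ * D q p₁ p₂).trace) q‖ ≤ M) :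
    ∀ q ∈ VertexTori w, ‖jetFunctional (fun q p₁ p₂ => ((A₃ q p₁ p₂)⁻¹ * B q p₁ p₂).trace
        - ((A₃ q p₁ p₂)⁻¹ * C q p₁ p₂ * (A' q p₁ p₂)⁻¹ * D q p₁ p₂).trace) q‖ ≤ M :=
  jet_norm_le_vertexTori_of_plusRegion Vs
    (fun ν hν q p₁ p₂ => oneLoopForm₃_invariantQ (hVU ν hν) (hA ν hν) (hA' ν hν) (hB ν hν) (hC ν hν) (hD ν hν) q p₁ p₂) hM

end Shift

end

end Summit.QuantumFields.BalabanUV.Beta.VertexToriSymmetry
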